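import Summits.BirchSwinnertonDyer.BirchSwinnertonDyer.Theorems.ResidualThetaTransportAtTwoResidualLambdaFormulaNegDiscAtTwoRankZeroOfPoitouTate
import Summits.BirchSwinnertonDyer.BirchSwinnertonDyer.Theorems.ThetaPartnerAtTwoSignedControlAtTwoStubPoitouTateShaRat
import Summits.BirchSwinnertonDyer.BirchSwinnertonDyer.Theorems.ThetaPartnerAtTwoSignedControlAtTwoStubPoitouTateSelmerRat
import Summits.BirchSwinnertonDyer.BirchSwinnertonDyer.Theorems.ThetaPartnerAtTwoSignedControlAtTwoShaThreeBaseH3Units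
import Literature.NumberTheory.GaloisCohomology.PoitouTateTwoRealPlacesSurjectiveHolds
import HarnessLib

/-!
# RLF `ResidualLambdaFormulaNegDiscAtTwo` (stmt-BirchSwinnertonDyer-23110) at analytic rank `0` from GZK ALONE —
# the four generic Poitou–Tate rows over `ℚ` of the rank-`0` RLF door are theorems

Routes `ResidualThetaTransportAtTwo` (RTT, crux r201) / `ThetaPartnerAtTwo` (aside), item 23110 `ResidualLambdaFormulaNegDiscAtTwo`
(the Greenberg–Vatsal residual λ-formula at `p = 2` on the `Δ < 0` branch; OPEN).  Seat `bsd-inputs-r1-p1` (gen 2) proved its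
restriction to analytic rank `0` from the four Poitou–Tate rows over `ℚ` and GZK
(`ResidualThetaLayer.residualLambdaFormulaNegDiscAtTwo_rankZero_of_poitouTate_four`, p621767; itself the PT-keyed twin of rtt-p2's
`…_rankZero_of_pub`, p606111, keyed on Greenberg 1999 ×4).  Since 2026-08-28 11:36Z all four rows are THEOREMS of the tree:
4.10 (b) `SignedEC.PoitouTateSelmerRat.stub_poitouTateSelmerRat` (p625615), 4.10 (a) `SignedEC.PoitouTateShaRat.stub_poitouTateShaRat`
(p629917), 4.10 (c)₃ `SignedEC.ShaThreeBrauer.poitouTate_three_realPlaces_injective_holds ℚ` (p628282), Cor. 4.16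
`poitouTate_two_realPlaces_surjective_holds ℚ` (p618871).  This file discharges them:

* **`residualLambdaFormulaNegDiscAtTwo_rankZero_of_gzk : RankEqAnalyticRankLeOne →`** ⟨23110's text with `E.analyticRank = 0 →`
  inserted after `E.Δ < 0 →`, VERBATIM the door's⟩.

So on the analytic-rank-`0` part of the habitat the residual λ-formula at `2` (Δ < 0) holds modulo Gross–Zagier–Kolyvagin ONLY —
no Greenberg 1999 (Props. 4.12/4.13, corank count), no Kato Thm. 12.4, no named Poitou–Tate fact.  Item 23110 itself (every `E` of
the branch, no rank hypothesis) stays OPEN.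

Seat `prover-bsd-wall-tp2-p3-w3` (K4 width 3/3, gen 10), `--supports stmt-BirchSwinnertonDyer-23110`; one `exact`, nothing re-derived.
HONEST FRAMING: CONDITIONAL on GZK (`rank_eq_analyticRank_of_analyticRank_le_one`, published); closes no item; BSD is NOT proved by
any of this.
-/

set_option autoImplicit false
-- the Theorems namespace of this sub repeats the summit name by design (D-0017 nested layout)
set_option linter.dupNamespace false

noncomputable section

open scoped Classical

open Literature.NumberTheory.EllipticCurves Literature.NumberTheory.GaloisCohomology

namespace Summit.BirchSwinnertonDyer.BirchSwinnertonDyer.Theorems.ResidualThetaLayer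

/-- **Item 23110 at analytic rank `0` from GZK alone**: the door `residualLambdaFormulaNegDiscAtTwo_rankZero_of_poitouTate_four` with
its four Poitou–Tate rows over `ℚ` discharged by the tree theorems (4.10 (b), 4.10 (a), 4.10 (c)₃, Cor. 4.16).  Conditional on GZK;
closes nothing; BSD is not proved by this.
[cite: MilneADT2006, Ch. I, Thm. 4.10 (a),(b),(c), Cor. 4.16] [cite: GreenbergVatsal2000, Prop. 2.8 and (10)] [cite: Kolyvagin1990, Thm. A] -/
theorem residualLambdaFormulaNegDiscAtTwo_rankZero_of_gzk
    (hGZK : Summit.BirchSwinnertonDyer.BirchSwinnertonDyer.Theses.ResidualThetaTransportAtTwo.RankEqAnalyticRankLeOne) :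
    ∀ (κ : Literature.NumberTheory.EllipticCurves.ZpExtension ℚ 2) (γ : Field.absoluteGaloisGroup ℚ), κ.IsCyclotomic →
      κ.IsTopGenerator γ →
      ∀ (S₀ : Finset (IsDedekindDomain.HeightOneSpectrum (NumberField.RingOfIntegers ℚ))), (∀ v ∈ S₀, ((2 : ℕ) : NumberField.RingOfIntegers ℚ) ∉ v.asIdeal) →
      ∃ c : ℕ, ∀ (E : WeierstrassCurve ℚ) [E.IsElliptic] [E.IsGloballyMinimal], Literature.NumberTheory.EllipticCurves.Rank1Residual.GoodSS E 2 →
      E.frobeniusTrace 2 = 0 → E.Δ < 0 → E.analyticRank = 0 →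
      (∀ v : IsDedekindDomain.HeightOneSpectrum (NumberField.RingOfIntegers ℚ), ¬ E.HasGoodReductionAt v → v ∈ S₀) →
      ∀ (D : Literature.NumberTheory.EllipticCurves.Kobayashi2003.SignedSelmerDualData E κ γ 1) [Module.Finite (Literature.NumberTheory.EllipticCurves.IwasawaAlgebra 2) D.X], Module.IsTorsion (Literature.NumberTheory.EllipticCurves.IwasawaAlgebra 2) D.X →
      D.mu = 0 →
      {x : Literature.NumberTheory.EllipticCurves.subgroupH1 κ.kerSubgroup ↥(AddSubgroup.torsionBy ↥(E.geomPrimaryTorsion 2) (2 : ℤ)) | x ∈ Literature.NumberTheory.EllipticCurves.GreenbergVatsal2000.unramifiedOutside κ.kerSubgroup ↥(AddSubgroup.torsionBy ↥(E.geomPrimaryTorsion 2) (2 : ℤ)) 2 (↑S₀ : Set (IsDedekindDomain.HeightOneSpectrum (NumberField.RingOfIntegers ℚ))) ∧ (∀ (w : NumberField.InfinitePlace ℚ) (σ : Field.absoluteGaloisGroup ℚ), Literature.NumberTheory.EllipticCurves.conjH1 κ.kerSubgroup ↥(AddSubgroup.torsionBy ↥(E.geomPrimaryTorsion 2) (2 :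 ℤ)) σ x ∈ Literature.NumberTheory.EllipticCurves.GreenbergSelmer.infKer κ.kerSubgroup ↥(AddSubgroup.torsionBy ↥(E.geomPrimaryTorsion 2) (2 : ℤ)) w) ∧ (∀ (v : IsDedekindDomain.HeightOneSpectrum (NumberField.RingOfIntegers ℚ)), ((2 : ℕ) : NumberField.RingOfIntegers ℚ) ∈ v.asIdeal →
      ∀ σ : Field.absoluteGaloisGroup ℚ, E.conjH1 2 κ.kerSubgroup σ (Literature.NumberTheory.EllipticCurves.GreenbergVatsal2000.pushH1 κ.kerSubgroup (AddSubgroup.torsionBy ↥(E.geomPrimaryTorsion 2) (2 : ℤ)).subtype (fun _ _ ↦ rfl) x) ∈ Literature.NumberTheory.EllipticCurves.Kobayashi2003.localKummerOverOfEmb E 2 κ.kerSubgroup (Literature.NumberTheory.EllipticCurves.closureEmb (K := ℚ) (v.adicCompletion ℚ)) (⨆ n : ℕ, Literature.NumberTheory.EllipticCurves.Kobayashi2003.signedLocalPoints κ (v.adicCompletion ℚ) E 1 n))}.ncard = 2 ^ (Literature.NumberTheory.EllipticCurves.lambdaInvariant 2 D.X + ∑ v ∈ S₀, 2 ^ padicValNat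 2 ((Rat.HeightOneSpectrum.natGenerator v ^ 2 - 1) / 8) * Literature.NumberTheory.EllipticCurves.GreenbergVatsal2000.dMultiplicity E 2 v + c) :=
  residualLambdaFormulaNegDiscAtTwo_rankZero_of_poitouTate_four SignedEC.PoitouTateSelmerRat.stub_poitouTateSelmerRat
    SignedEC.PoitouTateShaRat.stub_poitouTateShaRat (SignedEC.ShaThreeBrauer.poitouTate_three_realPlaces_injective_holds ℚ)
    (poitouTate_two_realPlaces_surjective_holds ℚ) hGZK

end Summit.BirchSwinnertonDyer.BirchSwinnertonDyer.Theorems.ResidualThetaLayer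

end
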